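import Summits.Langlands.Langlands.Theses.HolomorphicShadow

/-!
BC3 birth skeleton — child `WeakAutomorphyOffEvenArtin` of `HolomorphicShadow.SectorComplement` (stmt-Langlands-14623),
crux-strategist planner-cstrat-stmt-Langlands-14623-r1-0, 2026-08-17.  Named stubs (the ONLY sorries) and
`WeakAutomorphyOffEvenArtin_of : stubs → WeakAutomorphyOffEvenArtin` kernel-checked.  Context = the route file's (child restated verbatim from Sketch.lean /
children.json; after the split the `def` is deleted and the namespace line kept, cf. post/).
Cut by base field (the Shimura / non-Shimura dichotomy of every automorphy-lifting engine): B⁻ ⟸ B₁ (K totally real or CM,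
off the plane) ∧ B₂ (K neither; the plane condition is vacuous there but carried verbatim).
-/

set_option linter.dupNamespace false

namespace Summit.Langlands.Langlands.Theses.HolomorphicShadow

open scoped BigOperators Topology Manifold Classical MeasureTheory ProbabilityTheory Matrix InnerProductSpace ComplexConjugate ContinuousMap
open Filter Set Function TopologicalSpace MeasureTheory

/-- Piece B⁻ — weak automorphy off the even Artin plane (pre-split stand-in; byte-identical with children.json). -/
def WeakAutomorphyOffEvenArtin : Prop :=
  ∀ (K : Type) [Field K] [NumberField K] (n : ℕ) (hcpt : Literature.NumberTheory.Automorphic.isCompact_glFiniteIntegralLevel n K), 0 < n → ∀ (ℓ : ℕ) [Fact ℓ.Prime] (ι : PadicAlgCl ℓ ≃+* ℂ) (ρ : Literature.NumberTheory.GaloisRepresentations.FramedGaloisRep K (PadicAlgCl ℓ) n), ρ.toGaloisRep.IsIrreducible → ((∀ᶠ v : IsDedekindDomain.HeightOneSpectrum (NumberField.RingOfIntegers K) in cofinite, ρ.IsUnramifiedAt v) ∧ ∀ (v : IsDedekindDomain.HeightOneSpectrum (NumberField.RingOfIntegers K)) (hv : ((ℓ : ℕ) : NumberField.RingOfIntegers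 K) ∈ v.asIdeal), (Literature.NumberTheory.PAdicHodge.fontainePstAdicCompletion v ℓ hv).IsDeRhamFramed (ρ.toLocal v)) → ¬ (Module.finrank ℚ K = 1 ∧ n = 2 ∧ IsOpen (ρ.toMonoidHom.ker : Set (Field.absoluteGaloisGroup K)) ∧ (∀ (φ : K →+* ℝ) (c : Field.absoluteGaloisGroup K), Literature.NumberTheory.GaloisRepresentations.IsComplexConjugation φ c → Matrix.GeneralLinearGroup.det (ρ c) = 1)) → ∃ π : Literature.NumberTheory.Automorphic.CuspidalAutomorphicRepData n K hcpt, π.1.IsLAlgebraic ∧ ∀ᶠ v : IsDedekindDomain.HeightOneSpectrum (NumberField.RingOfIntegers K) in cofinite, SatakeFrobCompatibleAt ι π.1 ρ v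


namespace Cruxes.WeakAutomorphyOffEvenArtin.Birth

/-- **stub B₁ (OPEN off the known regimes: weak automorphy over TOTALLY REAL or CM fields, off the even Artin plane)** —
the world of every automorphy-lifting theorem (Taylor–Wiles–Kisin, Khare–Wintenberger for odd Artin `GL₂/ℚ`, BLGGT potential
automorphy, Calegari–Geraghty / ACC+ 2023 over CM fields, Pan 2022, Boxer–Calegari–Gee–Pilloni): irreducible pinned-geometric
`ρ : Γ_K → GL_n(ℚ̄_ℓ)`, `K` totally real or CM, NOT an even Artin-type `GL₂` representation over `K ≅ ℚ`, is Satake–Frobenius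
compatible a.e. with an L-algebraic cuspidal `π`.  Open in general (residual automorphy, irregular `ρ`, non-polarizable
`n ≥ 3` beyond ACC+, odd/general Artin in rank ≥ 3). [cite: FontaineMazurGeometric1995, Conj. 1] [cite: KhareWintenberger2009, Thm. 1.2]
[cite: BarnetlambEtAl2014, Thm. A] -/
theorem stub_offPlane_shimuraFields :
    ∀ (K : Type) [Field K] [NumberField K], (NumberField.IsTotallyReal K ∨ NumberField.IsCMField K) → ∀ (n : ℕ) (hcpt : Literature.NumberTheory.Automorphic.isCompact_glFiniteIntegralLevel n K), 0 < n → ∀ (ℓ : ℕ) [Fact ℓ.Prime] (ι : PadicAlgCl ℓ ≃+* ℂ) (ρ : Literature.NumberTheory.GaloisRepresentations.FramedGaloisRep K (PadicAlgCl ℓ) n), ρ.toGaloisRep.IsIrreducible → ((∀ᶠ v : IsDedekindDomain.HeightOneSpectrum (NumberField.RingOfIntegers K) in cofinite, ρ.IsUnramifiedAt v) ∧ ∀ (v : IsDedekindDomain.HeightOneSpectrum (NumberField.RingOfIntegers K)) (hv : ((ℓ : ℕ) : NumberField.RingOfIntegers K) ∈ v.asIdeal), (Literature.NumberTheory.PAdicHodge.fontainePstAdicCompletion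 v ℓ hv).IsDeRhamFramed (ρ.toLocal v)) → ¬ (Module.finrank ℚ K = 1 ∧ n = 2 ∧ IsOpen (ρ.toMonoidHom.ker : Set (Field.absoluteGaloisGroup K)) ∧ (∀ (φ : K →+* ℝ) (c : Field.absoluteGaloisGroup K), Literature.NumberTheory.GaloisRepresentations.IsComplexConjugation φ c → Matrix.GeneralLinearGroup.det (ρ c) = 1)) → ∃ π : Literature.NumberTheory.Automorphic.CuspidalAutomorphicRepData n K hcpt, π.1.IsLAlgebraic ∧ ∀ᶠ v : IsDedekindDomain.HeightOneSpectrum (NumberField.RingOfIntegers K) in cofinite, SatakeFrobCompatibleAt ι π.1 ρ v := by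
  sorry

/-- **stub B₂ (OPEN, no method at all: weak automorphy over number fields that are NEITHER totally real NOR CM)** — the far
side of `ShimuraVarietyRealizationBarrier` / `ShtukaConstantFieldBarrier` (no Shimura variety, defect `l₀ > 0`, potential
automorphy moves the problem to a CM extension without descent). [cite: FontaineMazurGeometric1995, Conj. 1]
[cite: BuzzardGeeLMS2014, Conj. 3.2.2] -/
theorem stub_offPlane_generalFields :
    ∀ (K : Type) [Field K] [NumberField K], ¬ (NumberField.IsTotallyReal K ∨ NumberField.IsCMField K) → ∀ (n : ℕ) (hcpt : Literature.NumberTheory.Automorphic.isCompact_glFiniteIntegralLevel n K), 0 < n → ∀ (ℓ : ℕ) [Fact ℓ.Prime] (ι : PadicAlgCl ℓ ≃+* ℂ) (ρ : Literature.NumberTheory.GaloisRepresentations.FramedGaloisRep K (PadicAlgCl ℓ) n), ρ.toGaloisRep.IsIrreducible → ((∀ᶠ v : IsDedekindDomain.HeightOneSpectrum (NumberField.RingOfIntegers K) in cofinite, ρ.IsUnramifiedAt v) ∧ ∀ (v : IsDedekindDomain.HeightOneSpectrum (NumberField.RingOfIntegers K)) (hv : ((ℓ : ℕ) : NumberField.RingOfIntegers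 K) ∈ v.asIdeal), (Literature.NumberTheory.PAdicHodge.fontainePstAdicCompletion v ℓ hv).IsDeRhamFramed (ρ.toLocal v)) → ¬ (Module.finrank ℚ K = 1 ∧ n = 2 ∧ IsOpen (ρ.toMonoidHom.ker : Set (Field.absoluteGaloisGroup K)) ∧ (∀ (φ : K →+* ℝ) (c : Field.absoluteGaloisGroup K), Literature.NumberTheory.GaloisRepresentations.IsComplexConjugation φ c → Matrix.GeneralLinearGroup.det (ρ c) = 1)) → ∃ π : Literature.NumberTheory.Automorphic.CuspidalAutomorphicRepData n K hcpt, π.1.IsLAlgebraic ∧ ∀ᶠ v : IsDedekindDomain.HeightOneSpectrum (NumberField.RingOfIntegers K) in cofinite, SatakeFrobCompatibleAt ι π.1 ρ v := by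
  sorry

/-- **B⁻ from its two stubs** (case split on the base field). -/
theorem WeakAutomorphyOffEvenArtin_of :
    (∀ (K : Type) [Field K] [NumberField K], (NumberField.IsTotallyReal K ∨ NumberField.IsCMField K) → ∀ (n : ℕ) (hcpt : Literature.NumberTheory.Automorphic.isCompact_glFiniteIntegralLevel n K), 0 < n → ∀ (ℓ : ℕ) [Fact ℓ.Prime] (ι : PadicAlgCl ℓ ≃+* ℂ) (ρ : Literature.NumberTheory.GaloisRepresentations.FramedGaloisRep K (PadicAlgCl ℓ) n), ρ.toGaloisRep.IsIrreducible → ((∀ᶠ v : IsDedekindDomain.HeightOneSpectrum (NumberField.RingOfIntegers K) in cofinite, ρ.IsUnramifiedAt v) ∧ ∀ (v : IsDedekindDomain.HeightOneSpectrum (NumberField.RingOfIntegers K)) (hv : ((ℓ : ℕ) : NumberField.RingOfIntegers K) ∈ v.asIdeal), (Literature.NumberTheory.PAdicHodge.fontainePstAdicCompletion v ℓ hv).IsDeRhamFramed (ρ.toLocal v)) → ¬ (Module.finrank ℚ K = 1 ∧ n = 2 ∧ IsOpen (ρ.toMonoidHom.ker : Set (Field.absoluteGaloisGroup K)) ∧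 (∀ (φ : K →+* ℝ) (c : Field.absoluteGaloisGroup K), Literature.NumberTheory.GaloisRepresentations.IsComplexConjugation φ c → Matrix.GeneralLinearGroup.det (ρ c) = 1)) → ∃ π : Literature.NumberTheory.Automorphic.CuspidalAutomorphicRepData n K hcpt, π.1.IsLAlgebraic ∧ ∀ᶠ v : IsDedekindDomain.HeightOneSpectrum (NumberField.RingOfIntegers K) in cofinite, SatakeFrobCompatibleAt ι π.1 ρ v) →
    (∀ (K : Type) [Field K] [NumberField K], ¬ (NumberField.IsTotallyReal K ∨ NumberField.IsCMField K) → ∀ (n : ℕ) (hcpt : Literature.NumberTheory.Automorphic.isCompact_glFiniteIntegralLevel n K), 0 < n → ∀ (ℓ : ℕ) [Fact ℓ.Prime] (ι : PadicAlgCl ℓ ≃+* ℂ) (ρ : Literature.NumberTheory.GaloisRepresentations.FramedGaloisRep K (PadicAlgCl ℓ) n), ρ.toGaloisRep.IsIrreducible → ((∀ᶠ v : IsDedekindDomain.HeightOneSpectrum (NumberField.RingOfIntegers K) in cofinite, ρ.IsUnramifiedAt v) ∧ ∀ (v : IsDedekindDomain.HeightOneSpectrum (NumberField.RingOfIntegers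 K)) (hv : ((ℓ : ℕ) : NumberField.RingOfIntegers K) ∈ v.asIdeal), (Literature.NumberTheory.PAdicHodge.fontainePstAdicCompletion v ℓ hv).IsDeRhamFramed (ρ.toLocal v)) → ¬ (Module.finrank ℚ K = 1 ∧ n = 2 ∧ IsOpen (ρ.toMonoidHom.ker : Set (Field.absoluteGaloisGroup K)) ∧ (∀ (φ : K →+* ℝ) (c : Field.absoluteGaloisGroup K), Literature.NumberTheory.GaloisRepresentations.IsComplexConjugation φ c → Matrix.GeneralLinearGroup.det (ρ c) = 1)) → ∃ π : Literature.NumberTheory.Automorphic.CuspidalAutomorphicRepData n K hcpt, π.1.IsLAlgebraic ∧ ∀ᶠ v : IsDedekindDomain.HeightOneSpectrum (NumberField.RingOfIntegers K) in cofinite, SatakeFrobCompatibleAt ι π.1 ρ v) →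
    WeakAutomorphyOffEvenArtin := by
  intro h1 h2 K _ _ n hcpt hn ℓ _ ι ρ hirr hgeo hs
  by_cases hK : NumberField.IsTotallyReal K ∨ NumberField.IsCMField K
  · exact h1 K hK n hcpt hn ℓ ι ρ hirr hgeo hs
  · exact h2 K hK n hcpt hn ℓ ι ρ hirr hgeo hs

/-- The composition with the stubs plugged in: `WeakAutomorphyOffEvenArtin` modulo exactly {B₁, B₂}. -/
theorem WeakAutomorphyOffEvenArtin_of_stubs : WeakAutomorphyOffEvenArtin :=
  WeakAutomorphyOffEvenArtin_of stub_offPlane_shimuraFields stub_offPlane_generalFields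

end Cruxes.WeakAutomorphyOffEvenArtin.Birth

end Summit.Langlands.Langlands.Theses.HolomorphicShadow
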